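import Mathlib
import HarnessLib
import Literature.MathematicalPhysics.StatisticalMechanics.RenormalisationMapKernelSub
import Literature.MathematicalPhysics.StatisticalMechanics.PolymerClosureGain
import Literature.MathematicalPhysics.StatisticalMechanics.ReblockingCounting

/-!
# The two-kernel comparison of the reblocked double sum of `S_k`: a CRUDE closed-form bound
# ([ABKM19] Lemma 12.6, hypothesis (12.53), Brouwer-grade constant)

`RenormalisationMapKernelSub.tayNormLE_sum_reblockTerm_kernel_sub_abkm` bounds the difference of the
reblocked double sums (`= K_{k+1}(U)`) for the same `(H, K)`, two extracted Hamiltonians `H̃, H̃'` and two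
step kernels `R_a, R_b` by an explicit four-summand expression.  Because Lemma 12.6 is used through
Brouwer's theorem (`RGFlowStableManifoldBrouwer`: the Lipschitz constants in the tuning parameter may be
as large as they like, e.g. depend on the volume), no gain has to be extracted from that expression: this
file bounds it CRUDELY, uniformly in the `(k+1)`-polymer `U`, by counting (at most `2^{|Λ|}` polymers,
at most `|Λ|` blocks, every elementary factor `≤ 10`):

* **`tayNormLE_sum_reblockTerm_kernel_sub_abkm_le`** — the difference is bounded in
  `|·|_{T_{k+1}^{U*}, w_{k+1}^U}` by `Γ · (‖H̃ − H̃'‖_{k,0} + ℓ · max(‖H‖_{k,0}, C))` with the explicit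
  `Γ = (2^{|Λ|})³ (10^{|Λ|})⁴ (144 |Λ| (1 ∨ A_{𝒫,a})^{|Λ|} + 30 (1 ∨ κ)^{|Λ|})` — linear in the two
  sources of `q`-dependence (the extracted Hamiltonian and the pair constant `ℓ` of Lemma 8.4) and in
  the size `max(‖H‖, ‖K‖)` of the data (the `X∖X₁ = ∅` terms vanish identically).

Everything is proved; no named fact.

## References
* S. Adams, S. Buchholz, R. Kotecký, S. Müller, arXiv:1910.13564, Lemma 12.6 (12.53), Lemma 9.6,
  Lemma 8.4 [AdamsBuchholzKoteckyMuller2019].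
-/

noncomputable section

namespace Literature.MathematicalPhysics.StatisticalMechanics.GradientRG

open scoped BigOperators Classical
open Finset Matrix
open Literature.MathematicalPhysics.StatisticalMechanics.TorusPolymer
  (IsPolymer blocks polys bprod blockOf thicken reblock mem_polys mem_blocks numBlocks isPolymer_blockOf
    thicken_mono thicken_mono_rad thicken_thicken subset_thicken card_blocks_eq_numBlocks card_polys_le_two_pow)
open Literature.Barriers.CriticalPhenomena.LongRangePhi4.Polymer (IsConn components)
open Literature.MathematicalPhysics.QuantumFieldTheory

variable {d M : ℕ} [NeZero M]

set_option maxHeartbeats 1600000 in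
/-- **Crude closed-form bound of the two-kernel comparison of the reblocked double sum** (module
docstring): under the hypotheses of `tayNormLE_sum_reblockTerm_kernel_sub_abkm` and `A ≥ 1`, `C ≤ 1`,
`|Σ_a(H̃) − Σ_b(H̃')|_{T_{k+1}^{U*}, w_{k+1}^U} ≤ Γ · (‖H̃ − H̃'‖_{k,0} + ℓ · max(‖H‖_{k,0}, C))`.
[cite: AdamsBuchholzKoteckyMuller2019, Lemma 12.6 (12.53)] -/
theorem tayNormLE_sum_reblockTerm_kernel_sub_abkm_le {L N Mord R n p r₀ : ℕ} {θbar lam μ δ₁ δ₀ A𝒫 A𝒫a A𝒫b C₂a C₂b h A : ℝ}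
    {𝒞 : ℕ → (Fin d → ZMod M) → ℝ} (hd : 3 ≤ d) (hLodd : Odd L) (hL : 2 ^ (d + 3) + 16 * R ≤ L)
    (hR2 : 2 ≤ R) (hM : M = L ^ N) {k : ℕ} (hkN : k + 1 ≤ N)
    {𝒞a 𝒞b : (Fin d → ZMod M) → ℝ}
    (hSa : StepKernelBounds (abkmWeightData L N Mord R θbar (schedDelta δ₀ δ₁ N) 𝒞) L k A𝒫a C₂a 𝒞a)
    (hSb : StepKernelBounds (abkmWeightData L N Mord R θbar (schedDelta δ₀ δ₁ N) 𝒞) L k A𝒫b C₂b 𝒞b)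
    (hp : d / 2 + 1 ≤ p) (hMord : d / 2 + 1 ≤ Mord)
   
    (hB : AbkmWeightBounds L N Mord R n θbar lam μ δ₁ δ₀ A𝒫 𝒞
      (abkmWeightData L N Mord R θbar (schedDelta δ₀ δ₁ N) 𝒞))
    (hδ₀ : 0 < δ₀) (hδ₁ : 0 < δ₁) (hh : 0 < h) (hh0 : hZeroSq d R δ₀ δ₁ ≤ h ^ 2) (hA𝒫 : 0 ≤ A𝒫a) (hA : 0 < A)
    {U : Finset (Fin d → ZMod M)} (hU : IsPolymer (L ^ (k + 1)) U)
    {Ht Ht' H : RelevantHamiltonian ℂ d} {τ : ℝ}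
    (hHt : hamNorm (fieldWt h (L : ℝ) d k) ((L : ℝ) ^ k) (L ^ (d * k)) Ht ≤ τ)
    (hHt' : hamNorm (fieldWt h (L : ℝ) d k) ((L : ℝ) ^ k) (L ^ (d * k)) Ht' ≤ τ) (hτ : τ ≤ 1 / 16)
    (hH : hamNorm (fieldWt h (L : ℝ) d k) ((L : ℝ) ^ k) (L ^ (d * k)) H ≤ 1 / 16)
    {K : Finset (Fin d → ZMod M) → ((Fin d → ZMod M) → ℝ) → ℂ} {C : ℝ} (hC : 0 ≤ C)
    (hK : WeakNormLE (abkmNormParams L N Mord R p r₀ h θbar A (schedDelta δ₀ δ₁ N) 𝒞) k K C)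
    (hKfac : Factorises (L ^ k) K) (hK0 : ∀ φ, K ∅ φ = 1) (hKd : ∀ Y, ContDiff ℝ r₀ (K Y))
    (hKloc : ∀ Y, IsPolymer (L ^ k) Y → IsConn Y →
      IsGaugeLocal ((abkmNormParams L N Mord R p r₀ h θbar A (schedDelta δ₀ δ₁ N) 𝒞).gauge k Y) (K Y))
    {ℓ κ : ℝ} (hℓ : 0 ≤ ℓ) (hκ : 0 ≤ κ)
    (hdiff : ∀ X : Finset (Fin d → ZMod M), IsPolymer (L ^ k) X →
      ∀ (F : ((Fin d → ZMod M) → ℝ) → ℂ) (b : ℝ), 0 ≤ b → ContDiff ℝ r₀ F →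
        IsGaugeLocal ((abkmNormParams L N Mord R p r₀ h θbar A (schedDelta δ₀ δ₁ N) 𝒞).gauge k X) F →
        TayNormLE ((abkmNormParams L N Mord R p r₀ h θbar A (schedDelta δ₀ δ₁ N) 𝒞).gauge k X) r₀
          ((abkmWeightData L N Mord R θbar (schedDelta δ₀ δ₁ N) 𝒞).weight k X) F b →
          TayNormLE ((abkmNormParams L N Mord R p r₀ h θbar A (schedDelta δ₀ δ₁ N) 𝒞).gauge k X) r₀
            ((abkmWeightData L N Mord R θbar (schedDelta δ₀ δ₁ N) 𝒞).midWeight k X)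
            (fluct 𝒞a F - fluct 𝒞b F) (b * ℓ * κ ^ numBlocks (L ^ k) X))
    (hA1 : 1 ≤ A) (hC1 : C ≤ 1) :
    TayNormLE ((abkmNormParams L N Mord R p r₀ h θbar A (schedDelta δ₀ δ₁ N) 𝒞).gauge (k + 1) U) r₀
      ((abkmWeightData L N Mord R θbar (schedDelta δ₀ δ₁ N) 𝒞).weight (k + 1) U)
      (fun φ => ∑ X ∈ (polys (L ^ k) univ).filter (fun X => reblock (L ^ k) (L * L ^ k) X = U),
        ∑ X₁ ∈ polys (L ^ k) X,
        (bprod (L ^ k) (fun B => expNegH Ht B φ) (U \ X) * bprod (L ^ k) (fun B => expNegH (-Ht) B φ) (X \ U) *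
            (bprod (L ^ k) (fun B => 1 - expNegH Ht B φ) X₁ * fluct 𝒞a (polyP2 (L ^ k) H K (X \ X₁)) φ) -
          bprod (L ^ k) (fun B => expNegH Ht' B φ) (U \ X) * bprod (L ^ k) (fun B => expNegH (-Ht') B φ) (X \ U) *
            (bprod (L ^ k) (fun B => 1 - expNegH Ht' B φ) X₁ *
              fluct 𝒞b (polyP2 (L ^ k) H K (X \ X₁)) φ)))
      (((2 : ℝ) ^ Fintype.card (Fin d → ZMod M)) ^ 3 * ((10 : ℝ) ^ Fintype.card (Fin d → ZMod M)) ^ 4 *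
          (144 * (Fintype.card (Fin d → ZMod M) : ℝ) * (max 1 A𝒫a) ^ Fintype.card (Fin d → ZMod M) +
            30 * (max 1 κ) ^ Fintype.card (Fin d → ZMod M)) *
        (hamNorm (fieldWt h (L : ℝ) d k) ((L : ℝ) ^ k) (L ^ (d * k)) (Ht - Ht') +
          ℓ * max (hamNorm (fieldWt h (L : ℝ) d k) ((L : ℝ) ^ k) (L ^ (d * k)) H) C)) := by
  set P := abkmNormParams L N Mord R p r₀ h θbar A (schedDelta δ₀ δ₁ N) 𝒞 with hP
  set W := abkmWeightData L N Mord R θbar (schedDelta δ₀ δ₁ N) 𝒞 with hW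
  have hL0 : (0 : ℝ) < L := by exact_mod_cast hLodd.pos
  -- the raw two-kernel bound
  have hD := tayNormLE_sum_reblockTerm_kernel_sub_abkm (p := p) (r₀ := r₀) (A := A) hd hLodd hL hR2 hM hkN hSa hSb hp hMord
    hB hδ₀ hδ₁ hh hh0 hA𝒫 hA hU hHt hHt' hτ hH hC hK hKfac hK0 hKd hKloc hℓ hκ hdiff
  refine hD.mono ?_ (fun φ => (W.weight_pos (k + 1) U φ).le)
  -- abbreviations
  set 𝔅 : ℕ := Fintype.card (Fin d → ZMod M) with h𝔅
  set T : ℝ := (10 : ℝ) ^ 𝔅 with hT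
  set 𝒩 : ℝ := (2 : ℝ) ^ 𝔅 with h𝒩
  set nH := hamNorm (fieldWt h (L : ℝ) d k) ((L : ℝ) ^ k) (L ^ (d * k)) H with hnH
  set nΔ := hamNorm (fieldWt h (L : ℝ) d k) ((L : ℝ) ^ k) (L ^ (d * k)) (Ht - Ht') with hnΔ
  set Δ := 16 * Real.exp (3 / 8) * nΔ with hΔdef
  set Ah := max 1 A𝒫a with hAh
  set κh := max 1 κ with hκh
  set m := max nH C with hm
  have hnn : ∀ H₀ : RelevantHamiltonian ℂ d,
      0 ≤ hamNorm (fieldWt h (L : ℝ) d k) ((L : ℝ) ^ k) (L ^ (d * k)) H₀ := fun H₀ =>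
    hamNorm_nonneg (fieldWt_pos hh hL0 d k).le (by positivity) _ H₀
  have hnH0 : 0 ≤ nH := hnn H
  have hnΔ0 : 0 ≤ nΔ := hnn _
  have hT1 : 1 ≤ T := one_le_pow₀ (by norm_num)
  have hT0 : 0 ≤ T := by positivity
  have h𝒩1 : 1 ≤ 𝒩 := one_le_pow₀ (by norm_num)
  have h𝒩0 : 0 ≤ 𝒩 := by positivity
  have hAh1 : 1 ≤ Ah := le_max_left _ _
  have hκh1 : 1 ≤ κh := le_max_left _ _
  have hm0 : 0 ≤ m := le_max_of_le_left hnH0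
  -- numerical constants
  have he1 : Real.exp 1 < 3 := lt_trans Real.exp_one_lt_d9 (by norm_num)
  have he14 : Real.exp (1 / 4) ≤ 3 := ((Real.exp_le_exp.2 (by norm_num : (1 / 4 : ℝ) ≤ 1)).trans he1.le)
  have he38 : Real.exp (3 / 8) ≤ 3 := ((Real.exp_le_exp.2 (by norm_num : (3 / 8 : ℝ) ≤ 1)).trans he1.le)
  have he14_0 : 0 ≤ Real.exp (1 / 4) := (Real.exp_pos _).le
  have hτ0 : 0 ≤ τ := (hnn Ht).trans hHt
  have hΔ0 : 0 ≤ Δ := by rw [hΔdef]; positivity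
  have hnΔle : nΔ ≤ 1 / 8 := by
    have hsub : nΔ ≤ hamNorm (fieldWt h (L : ℝ) d k) ((L : ℝ) ^ k) (L ^ (d * k)) Ht +
        hamNorm (fieldWt h (L : ℝ) d k) ((L : ℝ) ^ k) (L ^ (d * k)) Ht' :=
      hamNorm_sub_le (fieldWt_pos hh hL0 d k).le (by positivity) _ Ht Ht'
    linarith [hHt.trans hτ, hHt'.trans hτ]
  have hΔ6 : Δ ≤ 6 := by
    rw [hΔdef]
    calc 16 * Real.exp (3 / 8) * nΔ ≤ 16 * 3 * (1 / 8) := by gcongr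
      _ = 6 := by norm_num
  have hΔ48 : Δ ≤ 48 * nΔ := by
    rw [hΔdef]
    have : 16 * Real.exp (3 / 8) ≤ 48 := by linarith
    exact mul_le_mul_of_nonneg_right this hnΔ0
  have ha10 : Real.exp (1 / 4) + Δ ≤ 10 := by linarith
  have ha₃0 : 0 ≤ 8 * Real.exp (1 / 4) * τ := by positivity
  have ha₃10 : 8 * Real.exp (1 / 4) * τ + Δ ≤ 10 := by
    have : 8 * Real.exp (1 / 4) * τ ≤ 8 * 3 * (1 / 16) := by gcongr
    linarith
  have haH0 : 0 ≤ 8 * Real.exp (1 / 4) * nH := by positivity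
  have haH10 : 8 * Real.exp (1 / 4) * nH ≤ 10 := by
    have : 8 * Real.exp (1 / 4) * nH ≤ 8 * 3 * (1 / 16) := by gcongr
    linarith
  -- counting
  have hblocks : ∀ S : Finset (Fin d → ZMod M), (blocks (L ^ k) S).card ≤ 𝔅 := fun S =>
    Finset.card_image_le.trans (Finset.card_le_univ _)
  have hnum : ∀ S : Finset (Fin d → ZMod M), numBlocks (L ^ k) S ≤ 𝔅 := fun S => by
    rw [← card_blocks_eq_numBlocks]; exact hblocks S
  have hpolys : ∀ S : Finset (Fin d → ZMod M), ((polys (L ^ k) S).card : ℝ) ≤ 𝒩 := fun S => by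
    have h1 : (polys (L ^ k) S).card ≤ 2 ^ 𝔅 :=
      (card_polys_le_two_pow (L ^ k) S).trans (Nat.pow_le_pow_right (by norm_num) (hblocks S))
    rw [h𝒩]; exact_mod_cast h1
  have hcomp : ∀ Y : Finset (Fin d → ZMod M), (components Y).card ≤ 𝔅 := fun Y =>
    Finset.card_image_le.trans (Finset.card_le_univ _)
  -- elementary power estimates
  have hpowle : ∀ (x : ℝ) (n : ℕ), 0 ≤ x → x ≤ 10 → n ≤ 𝔅 → x ^ n ≤ T := by
    intro x n hx hx10 hn
    calc x ^ n ≤ (10 : ℝ) ^ n := pow_le_pow_left₀ hx hx10 n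
      _ ≤ (10 : ℝ) ^ 𝔅 := pow_le_pow_right₀ (by norm_num) hn
  have hpowsub : ∀ (x δ : ℝ) (n : ℕ), 0 ≤ x → 0 ≤ δ → x + δ ≤ 10 →
      (x + δ) ^ n - x ^ n ≤ n * δ * (10 : ℝ) ^ n := by
    intro x δ n hx hδ h10
    induction n with
    | zero => simp
    | succ n ih =>
      have hxn : x ^ n ≤ (10 : ℝ) ^ n := pow_le_pow_left₀ hx (by linarith) n
      have h10n : (10 : ℝ) ^ n ≤ (10 : ℝ) ^ (n + 1) := pow_le_pow_right₀ (by norm_num) (Nat.le_succ n)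
      have hxd : 0 ≤ x + δ := by linarith
      have e : (x + δ) ^ (n + 1) - x ^ (n + 1) = (x + δ) * ((x + δ) ^ n - x ^ n) + δ * x ^ n := by ring
      rw [e]
      have h1 : (x + δ) * ((x + δ) ^ n - x ^ n) ≤ 10 * (n * δ * (10 : ℝ) ^ n) :=
        mul_le_mul h10 ih (sub_nonneg.2 (pow_le_pow_left₀ hx (by linarith) n)) (by norm_num)
      have h2 : δ * x ^ n ≤ δ * (10 : ℝ) ^ (n + 1) := mul_le_mul_of_nonneg_left (hxn.trans h10n) hδ
      calc (x + δ) * ((x + δ) ^ n - x ^ n) + δ * x ^ n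
          ≤ 10 * (n * δ * (10 : ℝ) ^ n) + δ * (10 : ℝ) ^ (n + 1) := add_le_add h1 h2
        _ = ((n : ℝ) + 1) * δ * (10 : ℝ) ^ (n + 1) := by rw [pow_succ]; ring
        _ = ((n + 1 : ℕ) : ℝ) * δ * (10 : ℝ) ^ (n + 1) := by push_cast; ring
  have hprodsub : ∀ (S : Finset (Finset (Fin d → ZMod M))) (x δ : ℝ), 0 ≤ x → 0 ≤ δ → x + δ ≤ 10 →
      S.card ≤ 𝔅 → (∏ _B ∈ S, (x + δ)) - ∏ _B ∈ S, x ≤ δ * ((𝔅 : ℝ) * T) := by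
    intro S x δ hx hδ h10 hS
    rw [Finset.prod_const, Finset.prod_const]
    refine (hpowsub x δ S.card hx hδ h10).trans ?_
    have h1 : (S.card : ℝ) ≤ 𝔅 := by exact_mod_cast hS
    have h2 : (10 : ℝ) ^ S.card ≤ T := pow_le_pow_right₀ (by norm_num) hS
    calc (S.card : ℝ) * δ * (10 : ℝ) ^ S.card ≤ (𝔅 : ℝ) * δ * T := by gcongr
      _ = δ * ((𝔅 : ℝ) * T) := by ring
  have hprodsub0 : ∀ (S : Finset (Finset (Fin d → ZMod M))) (x δ : ℝ), 0 ≤ x → 0 ≤ δ →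
      0 ≤ (∏ _B ∈ S, (x + δ)) - ∏ _B ∈ S, x := by
    intro S x δ hx hδ
    exact sub_nonneg.2 (Finset.prod_le_prod (fun _ _ => hx) fun _ _ => by linarith)
  have hprodle : ∀ (S : Finset (Finset (Fin d → ZMod M))) (x : ℝ), 0 ≤ x → x ≤ 10 → S.card ≤ 𝔅 →
      ∏ _B ∈ S, x ≤ T := by
    intro S x hx h10 hS
    rw [Finset.prod_const]; exact hpowle x S.card hx h10 hS
  -- the `a`-factor and the inner `Y`-sum
  have haF : ∀ Z, 0 ≤ P.aFactor k Z := fun Z => (WeakNormLE.aFactor_pos hA k Z).le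
  have haF1 : ∀ Z, P.aFactor k Z ≤ 1 := fun Z => by
    show ((A ^ numBlocks (L ^ k) Z)⁻¹ : ℝ) ≤ 1
    exact inv_le_one_of_one_le₀ (one_le_pow₀ hA1)
  have hCaF1 : ∀ Z, C * P.aFactor k Z ≤ 1 := fun Z => mul_le_one₀ hC1 (haF Z) (haF1 Z)
  have hCaF0 : ∀ Z, 0 ≤ C * P.aFactor k Z := fun Z => mul_nonneg hC (haF Z)
  have hprodY1 : ∀ Y : Finset (Fin d → ZMod M), ∏ Z ∈ components Y, C * P.aFactor k Z ≤ 1 := fun Y =>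
    Finset.prod_le_one (fun Z _ => hCaF0 Z) fun Z _ => hCaF1 Z
  have hprodY0 : ∀ Y : Finset (Fin d → ZMod M), 0 ≤ ∏ Z ∈ components Y, C * P.aFactor k Z := fun Y =>
    Finset.prod_nonneg fun Z _ => hCaF0 Z
  have hYterm0 : ∀ X₂ Y : Finset (Fin d → ZMod M), 0 ≤ (∏ _B ∈ blocks (L ^ k) (X₂ \ Y), 8 * Real.exp (1 / 4) * nH) *
      ∏ Z ∈ components Y, C * P.aFactor k Z := fun X₂ Y =>
    mul_nonneg (Finset.prod_nonneg fun _ _ => haH0) (hprodY0 Y)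
  have hYterm : ∀ X₂ Y : Finset (Fin d → ZMod M), (∏ _B ∈ blocks (L ^ k) (X₂ \ Y), 8 * Real.exp (1 / 4) * nH) *
      ∏ Z ∈ components Y, C * P.aFactor k Z ≤ T := fun X₂ Y => by
    calc (∏ _B ∈ blocks (L ^ k) (X₂ \ Y), 8 * Real.exp (1 / 4) * nH) * ∏ Z ∈ components Y, C * P.aFactor k Z
        ≤ T * 1 := mul_le_mul (hprodle _ _ haH0 haH10 (hblocks _)) (hprodY1 Y) (hprodY0 Y) hT0
      _ = T := mul_one _
  have hbP2_0 : ∀ X₂ : Finset (Fin d → ZMod M), 0 ≤ ∑ Y ∈ polys (L ^ k) X₂,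
      (∏ _B ∈ blocks (L ^ k) (X₂ \ Y), 8 * Real.exp (1 / 4) * nH) * ∏ Z ∈ components Y, C * P.aFactor k Z :=
    fun X₂ => Finset.sum_nonneg fun Y _ => hYterm0 X₂ Y
  have hbP2 : ∀ X₂ : Finset (Fin d → ZMod M), ∑ Y ∈ polys (L ^ k) X₂,
      (∏ _B ∈ blocks (L ^ k) (X₂ \ Y), 8 * Real.exp (1 / 4) * nH) * ∏ Z ∈ components Y, C * P.aFactor k Z ≤
      𝒩 * T := fun X₂ => by
    calc ∑ Y ∈ polys (L ^ k) X₂, (∏ _B ∈ blocks (L ^ k) (X₂ \ Y), 8 * Real.exp (1 / 4) * nH) *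
          ∏ Z ∈ components Y, C * P.aFactor k Z
        ≤ ∑ _Y ∈ polys (L ^ k) X₂, T := Finset.sum_le_sum fun Y _ => hYterm X₂ Y
      _ = (polys (L ^ k) X₂).card * T := by rw [Finset.sum_const, nsmul_eq_mul]
      _ ≤ 𝒩 * T := mul_le_mul_of_nonneg_right (hpolys X₂) hT0
  -- the proportional bound of the `Y`-sum for a NON-EMPTY polymer `X₂`
  have hYprop : ∀ X₂ : Finset (Fin d → ZMod M), IsPolymer (L ^ k) X₂ → X₂ ≠ ∅ → ∀ Y ∈ polys (L ^ k) X₂,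
      (∏ _B ∈ blocks (L ^ k) (X₂ \ Y), 8 * Real.exp (1 / 4) * nH) * ∏ Z ∈ components Y, C * P.aFactor k Z ≤
        30 * T * m := by
    intro X₂ hX₂ hne Y hY
    obtain ⟨hYX, hYp⟩ := mem_polys.1 hY
    have h30T : 1 ≤ 30 * T := by nlinarith
    by_cases hb : blocks (L ^ k) (X₂ \ Y) = ∅
    · -- then `X₂ \ Y = ∅`, so `Y = X₂ ≠ ∅` and a factor `C` is available
      have hXY : X₂ \ Y = ∅ := by
        by_contra hne'
        obtain ⟨x, hx⟩ := Finset.nonempty_iff_ne_empty.2 hne'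
        have : blockOf (L ^ k) x ∈ blocks (L ^ k) (X₂ \ Y) := mem_blocks.2 ⟨x, hx, rfl⟩
        rw [hb] at this; exact absurd this (Finset.notMem_empty _)
      have hYeq : Y = X₂ := Finset.Subset.antisymm hYX (Finset.sdiff_eq_empty_iff_subset.1 hXY)
      have hYne : Y.Nonempty := by rw [hYeq]; exact Finset.nonempty_iff_ne_empty.2 hne
      obtain ⟨y, hy⟩ := hYne
      have hZ : Literature.Barriers.CriticalPhenomena.LongRangePhi4.Polymer.comp Y y ∈ components Y :=
        Finset.mem_image.2 ⟨y, hy, rfl⟩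
      rw [hb, Finset.prod_empty, one_mul, ← Finset.mul_prod_erase _ _ hZ]
      calc C * P.aFactor k (Literature.Barriers.CriticalPhenomena.LongRangePhi4.Polymer.comp Y y) *
            ∏ Z ∈ (components Y).erase (Literature.Barriers.CriticalPhenomena.LongRangePhi4.Polymer.comp Y y),
              C * P.aFactor k Z
          ≤ C * 1 * 1 :=
            mul_le_mul (mul_le_mul_of_nonneg_left (haF1 _) hC)
              (Finset.prod_le_one (fun Z _ => hCaF0 Z) fun Z _ => hCaF1 Z)
              (Finset.prod_nonneg fun Z _ => hCaF0 Z) (by positivity)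
        _ = C := by ring
        _ ≤ m := le_max_right _ _
        _ ≤ 30 * T * m := le_mul_of_one_le_left hm0 h30T
    · obtain ⟨B₀, hB₀⟩ := Finset.nonempty_iff_ne_empty.2 hb
      rw [← Finset.mul_prod_erase _ _ hB₀]
      have hrest : ∏ _B ∈ (blocks (L ^ k) (X₂ \ Y)).erase B₀, 8 * Real.exp (1 / 4) * nH ≤ T :=
        hprodle _ _ haH0 haH10 ((Finset.card_erase_le).trans (hblocks _))
      have h1 : Real.exp (1 / 4) * nH ≤ 3 * m := mul_le_mul he14 (le_max_left _ _) hnH0 (by norm_num)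
      calc 8 * Real.exp (1 / 4) * nH * (∏ _B ∈ (blocks (L ^ k) (X₂ \ Y)).erase B₀, 8 * Real.exp (1 / 4) * nH) *
            ∏ Z ∈ components Y, C * P.aFactor k Z
          ≤ 8 * Real.exp (1 / 4) * nH * T * 1 :=
            mul_le_mul (mul_le_mul_of_nonneg_left hrest haH0) (hprodY1 Y) (hprodY0 Y) (by positivity)
        _ = 8 * (Real.exp (1 / 4) * nH) * T := by ring
        _ ≤ 8 * (3 * m) * T := by gcongr
        _ ≤ 30 * T * m := by nlinarith [hm0, hT0]
  have hbP2prop : ∀ X₂ : Finset (Fin d → ZMod M), IsPolymer (L ^ k) X₂ → X₂ ≠ ∅ →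
      ∑ Y ∈ polys (L ^ k) X₂,
        (∏ _B ∈ blocks (L ^ k) (X₂ \ Y), 8 * Real.exp (1 / 4) * nH) * ∏ Z ∈ components Y, C * P.aFactor k Z ≤
      𝒩 * (30 * T * m) := by
    intro X₂ hX₂ hne
    calc ∑ Y ∈ polys (L ^ k) X₂, (∏ _B ∈ blocks (L ^ k) (X₂ \ Y), 8 * Real.exp (1 / 4) * nH) *
          ∏ Z ∈ components Y, C * P.aFactor k Z
        ≤ ∑ _Y ∈ polys (L ^ k) X₂, 30 * T * m := Finset.sum_le_sum fun Y hY => hYprop X₂ hX₂ hne Y hY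
      _ = (polys (L ^ k) X₂).card * (30 * T * m) := by rw [Finset.sum_const, nsmul_eq_mul]
      _ ≤ 𝒩 * (30 * T * m) := mul_le_mul_of_nonneg_right (hpolys X₂) (by positivity)
  -- powers of `A𝒫a`, `κ`
  have hApow : ∀ n : ℕ, n ≤ 𝔅 → A𝒫a ^ n ≤ Ah ^ 𝔅 := fun n hn =>
    (pow_le_pow_left₀ hA𝒫 (le_max_right 1 A𝒫a) n).trans (pow_le_pow_right₀ hAh1 hn)
  have hκpow : ∀ n : ℕ, n ≤ 𝔅 → κ ^ n ≤ κh ^ 𝔅 := fun n hn =>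
    (pow_le_pow_left₀ hκ (le_max_right 1 κ) n).trans (pow_le_pow_right₀ hκh1 hn)
  -- the index family
  set 𝓧 := (polys (L ^ k) univ).filter (fun X => reblock (L ^ k) (L * L ^ k) X = U) with h𝓧
  have h𝓧p : ∀ X ∈ 𝓧, IsPolymer (L ^ k) X := fun X hX => (mem_polys.1 (mem_filter.1 hX).1).2
  have h𝓧card : (𝓧.card : ℝ) ≤ 𝒩 := by
    have : (𝓧.card : ℝ) ≤ (polys (L ^ k) (univ : Finset (Fin d → ZMod M))).card := by
      exact_mod_cast Finset.card_filter_le _ _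
    exact this.trans (hpolys univ)
  -- the per-term bound
  set Φ : ℝ := 3 * (Δ * ((𝔅 : ℝ) * T) * T * (T * (𝒩 * T * Ah ^ 𝔅))) +
      T * T * (T * (𝒩 * (30 * T * m) * ℓ * κh ^ 𝔅)) with hΦ
  have hΦ0 : 0 ≤ Φ := by positivity
  have hterm : ∀ X ∈ 𝓧, ∀ X₁ ∈ polys (L ^ k) X, (((∏ _B ∈ blocks (L ^ k) (U \ X), (Real.exp (1 / 4) + Δ)) - ∏ _B ∈ blocks (L ^ k) (U \ X), Real.exp (1 / 4)) * (∏ _B ∈ blocks (L ^ k) (X \ U), Real.exp (1 / 4)) * ((∏ _B ∈ blocks (L ^ k) X₁, 8 * Real.exp (1 / 4) * τ) * ((∑ Y ∈ polys (L ^ k) (X \ X₁), (∏ _B ∈ blocks (L ^ k) ((X \ X₁) \ Y), 8 * Real.exp (1 / 4) * nH) * ∏ Z ∈ components Y, C * P.aFactor k Z) * A𝒫a ^ numBlocks (L ^ k) (X \ X₁))) + (∏ _B ∈ blocks (L ^ k) (U \ X), Real.exp (1 / 4)) * ((∏ _B ∈ blocks (L ^ k) (X \ U), (Real.exp (1 /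 4) + Δ)) - ∏ _B ∈ blocks (L ^ k) (X \ U), Real.exp (1 / 4)) * ((∏ _B ∈ blocks (L ^ k) X₁, 8 * Real.exp (1 / 4) * τ) * ((∑ Y ∈ polys (L ^ k) (X \ X₁), (∏ _B ∈ blocks (L ^ k) ((X \ X₁) \ Y), 8 * Real.exp (1 / 4) * nH) * ∏ Z ∈ components Y, C * P.aFactor k Z) * A𝒫a ^ numBlocks (L ^ k) (X \ X₁))) + (∏ _B ∈ blocks (L ^ k) (U \ X), Real.exp (1 / 4)) * (∏ _B ∈ blocks (L ^ k) (X \ U), Real.exp (1 / 4)) * (((∏ _B ∈ blocks (L ^ k) X₁, (8 * Real.exp (1 / 4) * τ + Δ)) - ∏ _B ∈ blocks (L ^ k) X₁, 8 * Real.exp (1 / 4) * τ) * ((∑ Y ∈ polys (L ^ k) (X \ X₁), (∏ _B ∈ blocks (L ^ k) ((X \ X₁) \ Y), 8 * Real.exp (1 / 4) * nH) * ∏ Z ∈ components Y, C * P.aFactor k Z) * A𝒫a ^ numBlocks (L ^ k) (X \ X₁))) + (∏ _B ∈ blocks (L ^ k) (U \ X), Real.exp (1 / 4)) * (∏ _B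 ∈ blocks (L ^ k) (X \ U), Real.exp (1 / 4)) * ((∏ _B ∈ blocks (L ^ k) X₁, 8 * Real.exp (1 / 4) * τ) * (if X \ X₁ = ∅ then 0 else (∑ Y ∈ polys (L ^ k) (X \ X₁), (∏ _B ∈ blocks (L ^ k) ((X \ X₁) \ Y), 8 * Real.exp (1 / 4) * nH) * ∏ Z ∈ components Y, C * P.aFactor k Z) * ℓ * κ ^ numBlocks (L ^ k) (X \ X₁)))) ≤ Φ := by
    intro X hX X₁ hX₁
    have hXp := h𝓧p X hX
    obtain ⟨hX₁X, hX₁p⟩ := mem_polys.1 hX₁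
    have hX₂p : IsPolymer (L ^ k) (X \ X₁) := hXp.sdiff hX₁p
    -- the factors
    have hp1 : ∏ _B ∈ blocks (L ^ k) (U \ X), Real.exp (1 / 4) ≤ T :=
      hprodle _ _ he14_0 (by linarith) (hblocks _)
    have hp2 : ∏ _B ∈ blocks (L ^ k) (X \ U), Real.exp (1 / 4) ≤ T :=
      hprodle _ _ he14_0 (by linarith) (hblocks _)
    have hp3 : ∏ _B ∈ blocks (L ^ k) X₁, 8 * Real.exp (1 / 4) * τ ≤ T :=
      hprodle _ _ ha₃0 (by linarith) (hblocks _)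
    have hp1_0 : 0 ≤ ∏ _B ∈ blocks (L ^ k) (U \ X), Real.exp (1 / 4) := Finset.prod_nonneg fun _ _ => he14_0
    have hp2_0 : 0 ≤ ∏ _B ∈ blocks (L ^ k) (X \ U), Real.exp (1 / 4) := Finset.prod_nonneg fun _ _ => he14_0
    have hp3_0 : 0 ≤ ∏ _B ∈ blocks (L ^ k) X₁, 8 * Real.exp (1 / 4) * τ := Finset.prod_nonneg fun _ _ => ha₃0
    have hp1d : (∏ _B ∈ blocks (L ^ k) (U \ X), (Real.exp (1 / 4) + Δ)) - ∏ _B ∈ blocks (L ^ k) (U \ X), Real.exp (1 / 4) ≤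
        Δ * ((𝔅 : ℝ) * T) := hprodsub _ _ _ he14_0 hΔ0 ha10 (hblocks _)
    have hp2d : (∏ _B ∈ blocks (L ^ k) (X \ U), (Real.exp (1 / 4) + Δ)) - ∏ _B ∈ blocks (L ^ k) (X \ U), Real.exp (1 / 4) ≤
        Δ * ((𝔅 : ℝ) * T) := hprodsub _ _ _ he14_0 hΔ0 ha10 (hblocks _)
    have hp3d : (∏ _B ∈ blocks (L ^ k) X₁, (8 * Real.exp (1 / 4) * τ + Δ)) - ∏ _B ∈ blocks (L ^ k) X₁, 8 * Real.exp (1 / 4) * τ ≤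
        Δ * ((𝔅 : ℝ) * T) := hprodsub _ _ _ ha₃0 hΔ0 ha₃10 (hblocks _)
    have hp1d_0 : 0 ≤ (∏ _B ∈ blocks (L ^ k) (U \ X), (Real.exp (1 / 4) + Δ)) - ∏ _B ∈ blocks (L ^ k) (U \ X), Real.exp (1 / 4) :=
      hprodsub0 _ _ _ he14_0 hΔ0
    have hp2d_0 : 0 ≤ (∏ _B ∈ blocks (L ^ k) (X \ U), (Real.exp (1 / 4) + Δ)) - ∏ _B ∈ blocks (L ^ k) (X \ U), Real.exp (1 / 4) :=
      hprodsub0 _ _ _ he14_0 hΔ0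
    have hp3d_0 : 0 ≤ (∏ _B ∈ blocks (L ^ k) X₁, (8 * Real.exp (1 / 4) * τ + Δ)) - ∏ _B ∈ blocks (L ^ k) X₁, 8 * Real.exp (1 / 4) * τ :=
      hprodsub0 _ _ _ ha₃0 hΔ0
    have hG : (∑ Y ∈ polys (L ^ k) (X \ X₁), (∏ _B ∈ blocks (L ^ k) ((X \ X₁) \ Y), 8 * Real.exp (1 / 4) * nH) * ∏ Z ∈ components Y, C * P.aFactor k Z) * A𝒫a ^ numBlocks (L ^ k) (X \ X₁) ≤ 𝒩 * T * Ah ^ 𝔅 :=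
      mul_le_mul (hbP2 _) (hApow _ (hnum _)) (pow_nonneg hA𝒫 _) (by positivity)
    have hG_0 : 0 ≤ (∑ Y ∈ polys (L ^ k) (X \ X₁), (∏ _B ∈ blocks (L ^ k) ((X \ X₁) \ Y), 8 * Real.exp (1 / 4) * nH) * ∏ Z ∈ components Y, C * P.aFactor k Z) * A𝒫a ^ numBlocks (L ^ k) (X \ X₁) := mul_nonneg (hbP2_0 _) (pow_nonneg hA𝒫 _)
    have hρ : (if X \ X₁ = ∅ then 0 else (∑ Y ∈ polys (L ^ k) (X \ X₁), (∏ _B ∈ blocks (L ^ k) ((X \ X₁) \ Y), 8 * Real.exp (1 / 4) * nH) * ∏ Z ∈ components Y, C * P.aFactor k Z) * ℓ * κ ^ numBlocks (L ^ k) (X \ X₁)) ≤ 𝒩 * (30 * T * m) * ℓ * κh ^ 𝔅 := by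
      split_ifs with h0
      · positivity
      · exact mul_le_mul (mul_le_mul_of_nonneg_right (hbP2prop _ hX₂p h0) hℓ) (hκpow _ (hnum _)) (pow_nonneg hκ _)
          (by positivity)
    have hρ_0 : 0 ≤ (if X \ X₁ = ∅ then 0 else (∑ Y ∈ polys (L ^ k) (X \ X₁), (∏ _B ∈ blocks (L ^ k) ((X \ X₁) \ Y), 8 * Real.exp (1 / 4) * nH) * ∏ Z ∈ components Y, C * P.aFactor k Z) * ℓ * κ ^ numBlocks (L ^ k) (X \ X₁)) := by
      split_ifs
      · exact le_rfl
      · exact mul_nonneg (mul_nonneg (hbP2_0 _) hℓ) (pow_nonneg hκ _)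
    -- the four summands
    have hS1 : ((∏ _B ∈ blocks (L ^ k) (U \ X), (Real.exp (1 / 4) + Δ)) - ∏ _B ∈ blocks (L ^ k) (U \ X), Real.exp (1 / 4)) *
        (∏ _B ∈ blocks (L ^ k) (X \ U), Real.exp (1 / 4)) *
        ((∏ _B ∈ blocks (L ^ k) X₁, 8 * Real.exp (1 / 4) * τ) * ((∑ Y ∈ polys (L ^ k) (X \ X₁), (∏ _B ∈ blocks (L ^ k) ((X \ X₁) \ Y), 8 * Real.exp (1 / 4) * nH) * ∏ Z ∈ components Y, C * P.aFactor k Z) * A𝒫a ^ numBlocks (L ^ k) (X \ X₁))) ≤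
        Δ * ((𝔅 : ℝ) * T) * T * (T * (𝒩 * T * Ah ^ 𝔅)) :=
      mul_le_mul (mul_le_mul hp1d hp2 hp2_0 (by positivity)) (mul_le_mul hp3 hG hG_0 hT0)
        (mul_nonneg hp3_0 hG_0) (by positivity)
    have hS2 : (∏ _B ∈ blocks (L ^ k) (U \ X), Real.exp (1 / 4)) *
        ((∏ _B ∈ blocks (L ^ k) (X \ U), (Real.exp (1 / 4) + Δ)) - ∏ _B ∈ blocks (L ^ k) (X \ U), Real.exp (1 / 4)) *
        ((∏ _B ∈ blocks (L ^ k) X₁, 8 * Real.exp (1 / 4) * τ) * ((∑ Y ∈ polys (L ^ k) (X \ X₁), (∏ _B ∈ blocks (L ^ k) ((X \ X₁) \ Y), 8 * Real.exp (1 / 4) * nH) * ∏ Z ∈ components Y, C * P.aFactor k Z) * A𝒫a ^ numBlocks (L ^ k) (X \ X₁))) ≤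
        T * (Δ * ((𝔅 : ℝ) * T)) * (T * (𝒩 * T * Ah ^ 𝔅)) :=
      mul_le_mul (mul_le_mul hp1 hp2d hp2d_0 hT0) (mul_le_mul hp3 hG hG_0 hT0)
        (mul_nonneg hp3_0 hG_0) (by positivity)
    have hS3 : (∏ _B ∈ blocks (L ^ k) (U \ X), Real.exp (1 / 4)) * (∏ _B ∈ blocks (L ^ k) (X \ U), Real.exp (1 / 4)) *
        (((∏ _B ∈ blocks (L ^ k) X₁, (8 * Real.exp (1 / 4) * τ + Δ)) - ∏ _B ∈ blocks (L ^ k) X₁, 8 * Real.exp (1 / 4) * τ) *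
          ((∑ Y ∈ polys (L ^ k) (X \ X₁), (∏ _B ∈ blocks (L ^ k) ((X \ X₁) \ Y), 8 * Real.exp (1 / 4) * nH) * ∏ Z ∈ components Y, C * P.aFactor k Z) * A𝒫a ^ numBlocks (L ^ k) (X \ X₁))) ≤
        T * T * (Δ * ((𝔅 : ℝ) * T) * (𝒩 * T * Ah ^ 𝔅)) :=
      mul_le_mul (mul_le_mul hp1 hp2 hp2_0 hT0) (mul_le_mul hp3d hG hG_0 (by positivity))
        (mul_nonneg hp3d_0 hG_0) (by positivity)
    have hS4 : (∏ _B ∈ blocks (L ^ k) (U \ X), Real.exp (1 / 4)) * (∏ _B ∈ blocks (L ^ k) (X \ U), Real.exp (1 / 4)) *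
        ((∏ _B ∈ blocks (L ^ k) X₁, 8 * Real.exp (1 / 4) * τ) *
          (if X \ X₁ = ∅ then 0 else (∑ Y ∈ polys (L ^ k) (X \ X₁), (∏ _B ∈ blocks (L ^ k) ((X \ X₁) \ Y), 8 * Real.exp (1 / 4) * nH) * ∏ Z ∈ components Y, C * P.aFactor k Z) * ℓ * κ ^ numBlocks (L ^ k) (X \ X₁))) ≤
        T * T * (T * (𝒩 * (30 * T * m) * ℓ * κh ^ 𝔅)) :=
      mul_le_mul (mul_le_mul hp1 hp2 hp2_0 hT0) (mul_le_mul hp3 hρ hρ_0 hT0) (mul_nonneg hp3_0 hρ_0) (by positivity)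
    have hsum := add_le_add (add_le_add (add_le_add hS1 hS2) hS3) hS4
    refine hsum.trans (le_of_eq ?_)
    rw [hΦ]; ring
  -- summation
  have hsum : ∑ X ∈ 𝓧, ∑ X₁ ∈ polys (L ^ k) X, (((∏ _B ∈ blocks (L ^ k) (U \ X), (Real.exp (1 / 4) + Δ)) - ∏ _B ∈ blocks (L ^ k) (U \ X), Real.exp (1 / 4)) * (∏ _B ∈ blocks (L ^ k) (X \ U), Real.exp (1 / 4)) * ((∏ _B ∈ blocks (L ^ k) X₁, 8 * Real.exp (1 / 4) * τ) * ((∑ Y ∈ polys (L ^ k) (X \ X₁), (∏ _B ∈ blocks (L ^ k) ((X \ X₁) \ Y), 8 * Real.exp (1 / 4) * nH) * ∏ Z ∈ components Y, C * P.aFactor k Z) * A𝒫a ^ numBlocks (L ^ k) (X \ X₁))) + (∏ _B ∈ blocks (L ^ k) (U \ X), Real.exp (1 / 4)) * ((∏ _B ∈ blocks (L ^ k) (X \ U), (Real.exp (1 / 4) + Δ)) - ∏ _B ∈ blocks (L ^ k) (X \ U), Real.exp (1 / 4)) * ((∏ _B ∈ blocks (L ^ k) X₁, 8 * Real.exp (1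 / 4) * τ) * ((∑ Y ∈ polys (L ^ k) (X \ X₁), (∏ _B ∈ blocks (L ^ k) ((X \ X₁) \ Y), 8 * Real.exp (1 / 4) * nH) * ∏ Z ∈ components Y, C * P.aFactor k Z) * A𝒫a ^ numBlocks (L ^ k) (X \ X₁))) + (∏ _B ∈ blocks (L ^ k) (U \ X), Real.exp (1 / 4)) * (∏ _B ∈ blocks (L ^ k) (X \ U), Real.exp (1 / 4)) * (((∏ _B ∈ blocks (L ^ k) X₁, (8 * Real.exp (1 / 4) * τ + Δ)) - ∏ _B ∈ blocks (L ^ k) X₁, 8 * Real.exp (1 / 4) * τ) * ((∑ Y ∈ polys (L ^ k) (X \ X₁), (∏ _B ∈ blocks (L ^ k) ((X \ X₁) \ Y), 8 * Real.exp (1 / 4) * nH) * ∏ Z ∈ components Y, C * P.aFactor k Z) * A𝒫a ^ numBlocks (L ^ k) (X \ X₁))) + (∏ _B ∈ blocks (L ^ k) (U \ X), Real.exp (1 / 4)) * (∏ _B ∈ blocks (L ^ k) (X \ U), Real.exp (1 / 4)) * ((∏ _B ∈ blocks (L ^ k) X₁, 8 * Real.exp (1 / 4) * τ) * (if X \ X₁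 = ∅ then 0 else (∑ Y ∈ polys (L ^ k) (X \ X₁), (∏ _B ∈ blocks (L ^ k) ((X \ X₁) \ Y), 8 * Real.exp (1 / 4) * nH) * ∏ Z ∈ components Y, C * P.aFactor k Z) * ℓ * κ ^ numBlocks (L ^ k) (X \ X₁)))) ≤ 𝒩 * (𝒩 * Φ) := by
    calc ∑ X ∈ 𝓧, ∑ X₁ ∈ polys (L ^ k) X, (((∏ _B ∈ blocks (L ^ k) (U \ X), (Real.exp (1 / 4) + Δ)) - ∏ _B ∈ blocks (L ^ k) (U \ X), Real.exp (1 / 4)) * (∏ _B ∈ blocks (L ^ k) (X \ U), Real.exp (1 / 4)) * ((∏ _B ∈ blocks (L ^ k) X₁, 8 * Real.exp (1 / 4) * τ) * ((∑ Y ∈ polys (L ^ k) (X \ X₁), (∏ _B ∈ blocks (L ^ k) ((X \ X₁) \ Y), 8 * Real.exp (1 / 4) * nH) * ∏ Z ∈ components Y, C * P.aFactor k Z) * A𝒫a ^ numBlocks (L ^ k) (X \ X₁))) + (∏ _B ∈ blocks (L ^ k) (U \ X), Real.exp (1 / 4)) * ((∏ _B ∈ blocks (L ^ k) (X \ U), (Real.exp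 (1 / 4) + Δ)) - ∏ _B ∈ blocks (L ^ k) (X \ U), Real.exp (1 / 4)) * ((∏ _B ∈ blocks (L ^ k) X₁, 8 * Real.exp (1 / 4) * τ) * ((∑ Y ∈ polys (L ^ k) (X \ X₁), (∏ _B ∈ blocks (L ^ k) ((X \ X₁) \ Y), 8 * Real.exp (1 / 4) * nH) * ∏ Z ∈ components Y, C * P.aFactor k Z) * A𝒫a ^ numBlocks (L ^ k) (X \ X₁))) + (∏ _B ∈ blocks (L ^ k) (U \ X), Real.exp (1 / 4)) * (∏ _B ∈ blocks (L ^ k) (X \ U), Real.exp (1 / 4)) * (((∏ _B ∈ blocks (L ^ k) X₁, (8 * Real.exp (1 / 4) * τ + Δ)) - ∏ _B ∈ blocks (L ^ k) X₁, 8 * Real.exp (1 / 4) * τ) * ((∑ Y ∈ polys (L ^ k) (X \ X₁), (∏ _B ∈ blocks (L ^ k) ((X \ X₁) \ Y), 8 * Real.exp (1 / 4) * nH) * ∏ Z ∈ components Y, C * P.aFactor k Z) * A𝒫a ^ numBlocks (L ^ k) (X \ X₁))) + (∏ _B ∈ blocks (L ^ k) (U \ X), Real.exp (1 / 4)) * (∏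 _B ∈ blocks (L ^ k) (X \ U), Real.exp (1 / 4)) * ((∏ _B ∈ blocks (L ^ k) X₁, 8 * Real.exp (1 / 4) * τ) * (if X \ X₁ = ∅ then 0 else (∑ Y ∈ polys (L ^ k) (X \ X₁), (∏ _B ∈ blocks (L ^ k) ((X \ X₁) \ Y), 8 * Real.exp (1 / 4) * nH) * ∏ Z ∈ components Y, C * P.aFactor k Z) * ℓ * κ ^ numBlocks (L ^ k) (X \ X₁))))
        ≤ ∑ X ∈ 𝓧, ∑ _X₁ ∈ polys (L ^ k) X, Φ :=
          Finset.sum_le_sum fun X hX => Finset.sum_le_sum fun X₁ hX₁ => hterm X hX X₁ hX₁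
      _ ≤ ∑ _X ∈ 𝓧, 𝒩 * Φ := Finset.sum_le_sum fun X _ => by
          rw [Finset.sum_const, nsmul_eq_mul]
          exact mul_le_mul_of_nonneg_right (hpolys X) hΦ0
      _ = 𝓧.card * (𝒩 * Φ) := by rw [Finset.sum_const, nsmul_eq_mul]
      _ ≤ 𝒩 * (𝒩 * Φ) := mul_le_mul_of_nonneg_right h𝓧card (by positivity)
  refine hsum.trans ?_
  -- `Δ ≤ 48‖H̃ − H̃'‖` and the closed form
  have hΦle : Φ ≤ 3 * (48 * nΔ * ((𝔅 : ℝ) * T) * T * (T * (𝒩 * T * Ah ^ 𝔅))) +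
      T * T * (T * (𝒩 * (30 * T * m) * ℓ * κh ^ 𝔅)) := by
    rw [hΦ]
    have : Δ * ((𝔅 : ℝ) * T) * T * (T * (𝒩 * T * Ah ^ 𝔅)) ≤ 48 * nΔ * ((𝔅 : ℝ) * T) * T * (T * (𝒩 * T * Ah ^ 𝔅)) := by
      gcongr
    linarith
  have hx : 0 ≤ 𝒩 ^ 3 * T ^ 4 * (144 * (𝔅 : ℝ) * Ah ^ 𝔅 * (ℓ * m) + 30 * κh ^ 𝔅 * nΔ) := by positivity
  have key : 𝒩 * (𝒩 * (3 * (48 * nΔ * ((𝔅 : ℝ) * T) * T * (T * (𝒩 * T * Ah ^ 𝔅))) +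
      T * T * (T * (𝒩 * (30 * T * m) * ℓ * κh ^ 𝔅)))) +
      𝒩 ^ 3 * T ^ 4 * (144 * (𝔅 : ℝ) * Ah ^ 𝔅 * (ℓ * m) + 30 * κh ^ 𝔅 * nΔ) =
      𝒩 ^ 3 * T ^ 4 * (144 * (𝔅 : ℝ) * Ah ^ 𝔅 + 30 * κh ^ 𝔅) * (nΔ + ℓ * m) := by ring
  have h2 : 𝒩 * (𝒩 * Φ) ≤ 𝒩 * (𝒩 * (3 * (48 * nΔ * ((𝔅 : ℝ) * T) * T * (T * (𝒩 * T * Ah ^ 𝔅))) +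
      T * T * (T * (𝒩 * (30 * T * m) * ℓ * κh ^ 𝔅)))) :=
    mul_le_mul_of_nonneg_left (mul_le_mul_of_nonneg_left hΦle h𝒩0) h𝒩0
  linarith


end Literature.MathematicalPhysics.StatisticalMechanics.GradientRG

end
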